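import Literature.MathematicalPhysics.QuantumFieldTheory.Balaban1983to89.B1Eq324BenfattoSect5JointCumulants
import HarnessLib

/-!
# `Balaban1983to89.B1Eq324BenfattoSect5PerBox` — [BenfattoEtAl1978] §5 pp. 157–159, displays (5.25), (5.28), (5.30),
# (5.31), (5.33) and the upper twin (5.36): THE PER-BOX ASSEMBLY ALGEBRA of the proof of the Basic Lemma, PROVED

statement-level skeleton of published theorems with citation tags; proofs where landed; nothing here is a claim about the
Yang–Mills mass gap

WHY THIS MODULE (cell `pub-ymgap`, seat `dag-n08-b`, node N08 «first missing estimate» lane; sequel of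
`B1Eq324BenfattoSect5Cumulant` = (5.16)–(5.22)/(5.33) and `B1Eq324BenfattoSect5JointCumulants` = (5.25)–(5.26)).  The chain is
[Balaban1985UV3] (24)/(58) ⇐ [Balaban1982Higgs1] (3.24) ⇐ [BenfattoEtAl1978] Lemma p. 152 (`B1Eq324BenfattoLemma.BasicLemmaPrinted`)
⇐ its §5 proof.  With the per-box cumulant expansion (5.22), the «Leibnitz formula» (5.25), the a-priori bound (5.26), the
χ-removal (5.29)₁ (`…Sect5ChiToOne`), Appendix D (`…AppendixDClustering`/`…AppendixDWick`) and the conditioned-versus-free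
comparison (5.31) (`…Sect5CondToFree`) all tree theorems, what §5 does next, pp. 157–159, is BOOKKEEPING FOR ONE BOX `□`: split
`Ψ_□ = Ψ′₁ + Ψ″₁ + Ψ₂ + Ψ₃` ((5.23), (5.27)), expand every `𝓔^T(Ψ_□χ; k)` over the pieces ((5.25), (5.28), (5.31)), discard
the `Ψ₃`-terms (5.26) and the `Ψ″₁ × Ψ₂` cross terms (5.29), replace the `Ψ″₁ × Ψ′₁` terms by their FREE values `Ê₀^T`
(5.31) — numbers that no longer depend on the conditioning `z_{Γ₁}` and are pulled out of the integral in (5.32) — and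
re-sum what is left, the `Ψ′₁ × Ψ₂` terms of all orders, «using the cumulant formula backwards» (5.33) into the factor
`∫P̄(dz_□|z_{Γ₁}) χ_□^b exp(Ψ′₁ + Ψ₂)` that the Markov property reassembles in (5.34)–(5.35).  This module proves that
per-box algebra ONCE, on an abstract probability space, with every analytic supplier entering as a hypothesis in the exact
currency the landed generic theorems produce (single-variable `truncExp`, joint truncated expectations as
`LatticeModels.ursellOf` of joint moments over colourings of the slots), in both directions (the lower bound (4.7) and its
«τ opposite» upper twin (5.36)).  It is layer 1 of the assembly of `BasicLemmaPrinted`; the product over the pavement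
`Q^b`, (5.34)/(5.35), the displaced pavements of p. 159 and `b*` are NOT here.

THE PRINTED TEXT (pp. 157–159; verbatim from the page images `bcg_p157_s3.png`, `bcg_p158_s3.png`, `bcg_p159_s3.png` of
the lit-balaban store, read as images; ⟦sic⟧ marks print as found; (5.23)–(5.26) are quoted in `…Sect5JointCumulants`).
p. 157: *"To treat the second term we define Γ₄(□) as the corridor adjacent to the boundary of □′ contained inside □′ and
with width b^{3/2}/2 and decompose Ψ₁ as Ψ′₁ + Ψ″₁ where* `Ψ′₁ = H_{Γ₄(□)} + H_{Γ₄(□),Γ₃(□)}` (5.27). *The feature of Ψ″₁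
to be retained is that in its expression as a polynomial in the z_Δ's each monomials ⟦sic⟧ contains at least one z_Δ with
Δ ⊂ □′∖Γ₄(□). Then the second term in (5.25) can be written* `Σ_{k₂>0} k!/(k₁!k₂!) 𝓔^T_{z_Γ}(Ψ′₁χ, Ψ₂χ; k₁, k₂) +
Σ_{k₂>0; h₁,h₂, h₂>0, h₁+h₂=k−k₂} 𝓔^T_{z_{Γ₁}}(Ψ′₁χ, Ψ″₁χ, Ψ₂χ; h₁, h₂, k₂)` (5.28) *and the properties of the free field
allow to bound the second term of this sum as* `s₄((s₂b^{D+2d}A)^k e^{−b²/4} + (s₂b^{D+2d}A)^k e^{−ϰ̃b^{3/2}})` (5.29)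
p. 158: *where the first term comes from the replacement of the χ's by 1, the second from the properties of the conditioned
measure and from the Wick theorem (see Appendix D) and s_k and ϰ̃ are positive constants. We can summarize the above
calculations in the following relation:* `[(5.12)] ≧ exp(error) ∫P̄(dz_{Γ₁})χ^{Γ₁}_{γb} exp H_{Γ₁} (Π_{□∩J=∅} ∫P̄(dz_□|z_{Γ₁})χ_b^□)
Π_{□∩J≠∅} {exp[Σ₁ᵗ (1/k!) 𝓔^T_{z_{Γ₁}}(χ_b^□(H_{□′} + H_{□′,Γ₃(□)}); k) + Σ₁ᵗ_k Σ_{k₁+k₂=k, k₂>0} (1/(k₁!k₂!))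
𝓔^T_{z_{Γ₁}}(χ_b^□(H_{Γ₄(□)} + H_{Γ₄(□),Γ₃(□)}), χ_b^□(H_{Γ₂(□)} + H_{Γ₁(□),Γ₂(□)}); k₁, k₂)]}` (5.30). *The error has the
same form as the one appearing in the text of the lemma [Equation (4.6)] with different values of the constants (which
can be desumed from the above calculation). We now write* `𝓔^T_{z_{Γ₁}}(χ_□^b(H_{□′} + H_{□′,Γ₃(□)}); k) =
𝓔^T_{z_{Γ₁}}(χ_□^b(H_{Γ₄(□)} + H_{Γ₄(□),Γ₃(□)}); k) + Σ_{k₁+k₂=k, k₁>0} k!/(k₁!k₂!) 𝓔^T_{z_{Γ₁}}(χ_□^b(H_{□′} + H_{□′,Γ₃(□)}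
− H_{Γ₄(□)} − H_{Γ₄(□),Γ₃(□)}), χ_□^b(H_{Γ₄(□)} + H_{Γ₄(□),Γ₃(□)}); k₁, k₂) = 𝓔^T_{z_{Γ₁}}(χ_□^b(H_{Γ₄(□)} +
H_{Γ₄(□),Γ₃(□)}); k) + Σ_{k₁+k₂=k, k₁>0} k!/(k₁!k₂!) Ê₀^T((H_{□′} + H_{□,Γ₃(□)}) − H_{Γ₄(□)} − H_{Γ₄(□),Γ₃(□)},
H_{Γ₄(□)} + H_{Γ₄(□),Γ₃(□)}; k₁, k₂) + (error)` (5.31) *and the error can be studied along the same lines of the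
argument leading to the bound (5.30) and has the same form of (5.29) with new constants. Hence* `[(5.12)] ≧ exp(error)
∫P̄(dz_{Γ₁})χ^{Γ₁}_{γb} (Π_{□∩J=∅} ∫P̄(dz_□|z_{Γ₁})χ_b^□)·exp[Σ₁ᵗ_k Σ_{k₁+k₂=k, k₁>0} (1/(k₁!k₂!)) Σ_□ Ê₀^T(Ψ″₁, Ψ′₁;
k₁, k₂)]·exp H_{Γ₁} Π_{□∩J≠∅} {exp[Σ₁ᵗ_k Σ_{k₁+k₂=k} (1/(k₁!k₂!)) 𝓔^T_{z_{Γ₁}}(χ_□^b(H_{Γ₄(□)} + H_{Γ₄(□),Γ₃(□)}),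
χ_□^b(H_{Γ₂(□)} + H_{Γ₁(□),Γ₂(□)}); k₁, k₂)]}` (5.32).  p. 159: *"Each factor in the product sign can be reexpressed using
the cumulant formula backwards as* `∫P̄(dz_□|z_{Γ₁})χ_□^b exp(H_{Γ₂(□)∪Γ₄(□)} + H_{Γ₂(□),Γ₁(□)} − H_{Γ₄(□),Γ₂(□)∖Γ₃(□)})
·exp{τ[(2^{(t+1)²}(t+1)!/(t+1)!)(s₂b^{D+2d}A)^{t+1} exp 2(s₂Ab^{D+2d})]}` (5.33) *where as usual τ is a function with values
in [−1, 1]." …* *"We now study the second estimate (4.6) which is obtained by simple modifications of the first one (4.7).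
We start from (5.13), then assuming |z_Δ| ≦ b(1 + d(Δ, I)), ∀Δ ∈ C* `[(5.12)] ≦ ∫P̄(dz_{Γ₁})χ_b^{Γ₁} exp H_{Γ₁}
(Π_{□∩J=∅} ∫P̄(dz_□|z_{Γ₁})χ_b^□)·(Π_{□∩J≠∅} ∫P̄(dz_□|z_{Γ₁}) exp Ψ_□χ_b^□)` (5.36). *By beeing ⟦sic⟧ careful in attributing
to the various τ the value opposite to the one chosen in the estimate (4.7) we obtain that (5.12) can be bounded above by
the r.h.s. of (5.35) with b replaced by γ⁻¹b."*

DICTIONARY.  `P̄(dz_□|z_{Γ₁})` ↦ any probability measure `μ`.  `χ_b^□` ↦ a measurable weight `0 ≤ χ ≤ 1` (§3; print's is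
an indicator: §4 `abs_log_setIntegral_perBox_le`).  The pieces: `Y 0 = Ψ′₁`, `Y 1 = Ψ″₁`, `Y 2 = Ψ₂`, `D = Ψ₃ = H′^{(l)}`
(`Y : Fin 3 → Ω → ℝ`, so that `Y₀+Y₁ = Ψ₁`, `Y₀+Y₁+Y₂+D = Ψ_□`, and `Y₀+Y₂ = Ψ′₁+Ψ₂ = H_{Γ₂∪Γ₄} + H_{Γ₂,Γ₁} −
H_{Γ₄,Γ₂∖Γ₃}` is the exponent of (5.33)).  `𝓔^T_{z_{Γ₁}}(X; k)` ↦ `B10Eq24Cumulant.truncExp X μ k`; a joint truncated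
expectation with multiplicities ↦ the Ursell function `LatticeModels.ursellOf (P ↦ ∫ Π_{j∈P} Y_{f(j)}χ dμ) univ` of a
colouring `f : Fin k → Fin 3` of the `k` slots (grouping colourings by multiplicity gives print's `k!/(k₁!k₂!)`; cf.
`…Sect5JointCumulants`, DICTIONARY).  «Colourings using `1` and `2`» = the second term of (5.28); «using `1`, avoiding
`2`» = the `k₁ > 0` sum of (5.31); `e₀(k)` ↦ print's `Σ_{k₁>0} k!/(k₁!k₂!) Ê₀^T(Ψ″₁,Ψ′₁;k₁,k₂)` (ANY real numbers here;
the free values at instantiation); `E₂₉(k)`, `E₃₁(k)` ↦ print's (5.29) and the «(error)» of (5.31) at order `k`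
(sum-level hypotheses here).  `K` ↦ `s₂Ab^{D+2d}` (point i) p. 155, for every partial exponent); `ε` ↦
`s₁Ab^{D+2d}e^{−ϰb^{3/2}/8}` (5.24); `W` ↦ `3b^{2d}e^{−b²/4}` (5.19); `2^{C(t+1,2)}K^{t+1}/(t+1)!` ↦ the kernel's
a-priori remainder of (5.21)/(5.33) (print's `2^{(t+1)²}(t+1)!e^{2K}`-constant dominates it,
`…Sect5Cumulant.apriori_le_printed`); `s_k = Σ_{π∈𝒫(k)}(|π|−1)!` ↦ print's `s₃`.

WHAT IS PROVED (theorems only; no definition, no named fact, no `sorry`; axioms standard).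
* §1 «Leibnitz» bookkeeping over colourings of `Fin k` slots: `truncExp_finsetSum_eq_sum_filter` (a sub-sum `Σ_{c∈S}Y_c`
  expands over the colourings WITH VALUES IN `S`), ★ **`truncExp_three_eq`** — (5.25)/(5.28)/(5.31)₁ as ONE identity
  `𝓔^T(Y₀+Y₁+Y₂;k) = 𝓔^T(Y₀+Y₂;k) + [𝓔^T(Y₀+Y₁;k) − 𝓔^T(Y₀;k)] + Σ_{f uses 1∧2} 𝓔^T(Y_f)` (inclusion–exclusion on the
  palette), **`truncExp_two_sub_eq`** ((5.31)₁: `𝓔^T(Y₀+Y₁;k) − 𝓔^T(Y₀;k) = Σ_{f uses 1, avoids 2} 𝓔^T(Y_f)`),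
  `abs_sum_filter_le_three_pow` (the «new constants»: at most `3^k` colourings).
* §2 the two brackets between `∫e^{X}` and `∫χe^{X}` in log form: `exp_neg_mul_integral_le_integral_mul_exp`,
  `log_integral_mul_exp_le_log_integral_exp` (trivial direction) and **`log_integral_exp_le_log_integral_mul_exp_add`**
  ((5.18) read upward: `log∫e^X ≤ log∫χe^X + e^{2K}W`, the «τ opposite» of (5.20)).
* §3 ★ **`abs_truncExp_four_sub_le`** (per order `k`: `|𝓔^T(Ψχ;k) − 𝓔^T((Y₀+Y₂)χ;k) − e₀(k)| ≤ 3^k s_k εK^{k−1} + E₂₉(k)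
  + E₃₁(k)`, (5.26) supplied BY NAME by `…Sect5JointCumulants.eq526_three`), ★★ **`eq530_lower`** — (5.22)+(5.25)–(5.33)
  chained: `log∫χe^{Ψχ} ≥ log∫χe^{(Y₀+Y₂)χ} + Σ_{k≤t}e₀(k)/k! − [2·2^{C(t+1,2)}K^{t+1}/(t+1)! + e^{2K}W + Σ_{k≤t}(3^k s_k
  εK^{k−1} + E₂₉(k) + E₃₁(k))/k!]` ((5.22) by `…Sect5Cumulant.sum_sub_sub_le_log_integral_mul_exp`, (5.33) by
  `…Sect5Cumulant.abs_log_integral_exp_sub_sum_le`), ★ **`eq536_upper`** (the same bound upward).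
* §4 ★★ **`abs_log_integral_perBox_le`** (two-sided), `integral_mul_exp_mul_eq_of_indicator` + ★ **`abs_log_setIntegral_perBox_le`**
  (print's indicator form: `|log∫_S e^{Ψ} − log∫_S e^{Ψ′₁+Ψ₂} − Σe₀/k!| ≤ error`, hypotheses ON the small-field event `S`),
  ★ **`abs_log_integral_perBox_le_of_colourings`** (the per-colouring entry point: `|𝓔^T((Yχ)_f)| ≤ δ₂₉(k)` on colourings
  using `1∧2`, `|𝓔^T((Yχ)_f) − u₀(k,f)| ≤ δ₃₁(k)` on colourings using `1` avoiding `2` ⟹ the relation with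
  `e₀(k) = Σ_f u₀(k,f)`, `E = 3^k δ`).
* §5 multiplicative forms (print's (5.30)/(5.32) are products of exponentials): **`eq530_lower_exp`**
  (`exp(Σe₀/k! − error)·∫χe^{(Y₀+Y₂)χ} ≤ ∫χe^{Ψχ}`), **`eq536_upper_exp`**.

HONEST SCOPE / NOT HERE.  (i) GENERIC: any probability space; print's objects enter only through the DICTIONARY.  The
instantiation on `condField d α β Γ₁ z̄` with the boxes line's `Ψ′₁, Ψ″₁, Ψ₂, Ψ₃` (`…Sect5Eq524` and its announced sequel),
and the DISCHARGE of the sum-level inputs `E₂₉`/`E₃₁` — by `…Sect5ChiToOne` (χ → 1, moment form; polynomial-slot moments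
from the announced `…Sect5SlotMoments`), `…AppendixDWick`/`…AppendixDClustering` (print's `e^{−ϰ̃b^{3/2}}` from the corridor geometry `dist(□′∖Γ₄(□), Γ₂(□)) ≥
b^{3/2}/2`) and `…Sect5CondToFree` ((5.31)'s «(error)») — is the NEXT layer and is not done here; in particular print's RATES
in (5.29) (`e^{−b²/4}`, `e^{−ϰ̃b^{3/2}}`) are not derived in this file.  (ii) AS PROVED vs AS PRINTED: two a-priori
remainders appear (one for `Ψχ` in (5.21), one for `(Ψ′₁+Ψ₂)χ` in (5.33) — exactly print's two `τ`-brackets), with the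
kernel constant `2^{C(t+1,2)}K^{t+1}/(t+1)!` each; the volume term `e^{2K}W` appears once in each direction ((5.20) downward,
(5.18) upward).  (iii) Print's intermediate display (5.30) (which still carries `𝓔^T(χΨ₁;k)`) is not stated separately: the
module goes from (5.22) to the (5.31)/(5.32) form in one identity (`truncExp_three_eq`).  (iv) NOT here: (5.23)/(5.24)/(5.27)
(what the pieces ARE and the decay of `H′^{(l)}` — boxes line), the products over `□ ∈ Q^b` and the Markov reassembly
(5.13)/(5.32)/(5.34)/(5.35), the displaced pavements and the collection of errors into (4.6)–(4.7) (p. 159), `b* = max{10⁴,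
γ⁻³b̄}`.  `BasicLemmaPrinted` stays OPEN.  NOT summit progress; count-neutral for N08; nothing of [Balaban1985UV3]
(41)/(47)/(5) is asserted.
-/

open MeasureTheory ProbabilityTheory Finset
open scoped BigOperators Nat

namespace Literature.MathematicalPhysics.QuantumFieldTheory.Balaban1983to89.B1Eq324BenfattoSect5PerBox

open _root_.MeasureTheory _root_.ProbabilityTheory
open Literature.Probability.LatticeModels
open Literature.MathematicalPhysics.QuantumFieldTheory.Balaban1983to89.B10Eq24Cumulant
open Literature.MathematicalPhysics.QuantumFieldTheory.Balaban1983to89.B1Eq324BenfattoSect5Cumulant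
open Literature.MathematicalPhysics.QuantumFieldTheory.Balaban1983to89.B1Eq324BenfattoSect5JointCumulants

/-! ## §1  «Leibnitz formula» bookkeeping: truncated expectations of sub-sums as sums over colourings -/

section Colourings

variable {Ω : Type*} {mΩ : MeasurableSpace Ω} {μ : Measure Ω} [IsProbabilityMeasure μ]
variable {σ ι : Type*} [Fintype σ] [DecidableEq σ] [Fintype ι] [DecidableEq ι]

/-- Inclusion–exclusion for two properties on a finite sum: the terms having BOTH properties are all terms, minus those
lacking the first, minus those lacking the second, plus those lacking both. [folklore] -/
private theorem sum_filter_and_incl_excl {β : Type*} (s : Finset β) (p q : β → Prop) [DecidablePred p] [DecidablePred q]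
    (g : β → ℝ) :
    ∑ x ∈ s.filter (fun x => p x ∧ q x), g x =
      ∑ x ∈ s, g x - ∑ x ∈ s.filter (fun x => ¬p x), g x - ∑ x ∈ s.filter (fun x => ¬q x), g x
        + ∑ x ∈ s.filter (fun x => ¬p x ∧ ¬q x), g x := by
  have h1 := Finset.sum_filter_add_sum_filter_not s p g
  have h2 := Finset.sum_filter_add_sum_filter_not (s.filter fun x => ¬q x) p g
  have h3 := Finset.sum_filter_add_sum_filter_not (s.filter p) q g
  rw [Finset.filter_filter, Finset.filter_filter] at h2 h3
  have e1 : s.filter (fun x => ¬q x ∧ p x) = s.filter (fun x => p x ∧ ¬q x) :=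
    Finset.filter_congr fun x _ => and_comm
  have e2 : s.filter (fun x => ¬q x ∧ ¬p x) = s.filter (fun x => ¬p x ∧ ¬q x) :=
    Finset.filter_congr fun x _ => and_comm
  rw [e1, e2] at h2
  linarith

/-- The colourings taking values in a sub-palette `S` are the colourings by `S`. [folklore] -/
private theorem sum_filter_forall_mem_eq {M : Type*} [AddCommMonoid M] (S : Finset ι) (n : ℕ)
    (g : (Fin (n + 1) → ι) → M) :
    ∑ f ∈ univ.filter (fun f : Fin (n + 1) → ι => ∀ j, f j ∈ S), g f =
      ∑ f' : Fin (n + 1) → {c // c ∈ S}, g (fun j => (f' j).1) := by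
  rw [Finset.sum_subtype (univ.filter (fun f : Fin (n + 1) → ι => ∀ j, f j ∈ S))
    (p := fun f : Fin (n + 1) → ι => ∀ j, f j ∈ S) (fun f => by simp)]
  exact Fintype.sum_equiv (Equiv.subtypePiEquivPi (α := Fin (n + 1)) (β := fun _ => ι) (p := fun _ c => c ∈ S))
    (fun f : {f : Fin (n + 1) → ι // ∀ j, f j ∈ S} => g f.1) (fun f' => g fun j => (f' j).1) fun _ => rfl

/-- **(5.25) FOR A SUB-SUM** («the elementary summation properties of the truncated functions», p. 157): for a finite
family `Y_c` of a.e. bounded variables under a probability measure and a nonempty sub-palette `S ⊆ ι`, the `k`-th truncated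
expectation of `Σ_{c∈S} Y_c` is the sum, over the colourings `f : {1,…,k} → ι` WITH VALUES IN `S`, of the joint truncated
expectations `𝓔^T(Y_{f(1)}, …, Y_{f(k)})` — `B1Eq324BenfattoSect5JointCumulants.truncExp_sum_eq_sum_ursellOf` for the
sub-family, re-indexed to colourings of the full palette. [cite: BenfattoEtAl1978, (5.25) p.157] -/
theorem truncExp_finsetSum_eq_sum_filter {Y : ι → Ω → ℝ} {K : ℝ} {S : Finset ι} (hS : S.Nonempty)
    (hYm : ∀ c, AEStronglyMeasurable (Y c) μ) (hYK : ∀ c, ∀ᵐ ω ∂μ, |Y c ω| ≤ K) (n : ℕ) :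
    truncExp (fun ω => ∑ c ∈ S, Y c ω) μ (n + 1) =
      ∑ f ∈ univ.filter (fun f : Fin (n + 1) → ι => ∀ j, f j ∈ S),
        ursellOf (fun P : Finset (Fin (n + 1)) => ∫ ω, ∏ j ∈ P, Y (f j) ω ∂μ) univ := by
  obtain ⟨c₀, hc₀⟩ := hS
  haveI : Nonempty {c // c ∈ S} := ⟨⟨c₀, hc₀⟩⟩
  have h := truncExp_sum_eq_sum_ursellOf (σ := Fin (n + 1)) (μ := μ) (Y := fun c : {c // c ∈ S} => Y c.1)
    (fun c => hYm c.1) (fun c => hYK c.1)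
  have hfun : (fun ω => ∑ c : {c // c ∈ S}, Y c.1 ω) = fun ω => ∑ c ∈ S, Y c ω := by
    funext ω
    exact Finset.sum_coe_sort S (fun c => Y c ω)
  rw [hfun, Fintype.card_fin] at h
  rw [h, sum_filter_forall_mem_eq S n]

/-- **(5.25) = (5.28) = (5.31) FOR THREE PIECES, AS ONE IDENTITY**: for a.e. bounded `Y₀, Y₁, Y₂` (print: `Y₀ = Ψ′₁χ`,
`Y₁ = Ψ″₁χ`, `Y₂ = Ψ₂χ`) and `k ≥ 1`,
`𝓔^T(Y₀+Y₁+Y₂; k) = 𝓔^T(Y₀+Y₂; k) + [𝓔^T(Y₀+Y₁; k) − 𝓔^T(Y₀; k)] + Σ_{f uses 1 and 2} 𝓔^T(Y_{f(1)},…,Y_{f(k)})`: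
the colourings of the `k` slots by `{0,1,2}` are those avoiding `1` (giving `𝓔^T(Y₀+Y₂;k)` — print's first term of
(5.28) summed with `𝓔^T(Ψ′₁χ;k)`), those using `1` but avoiding `2` (print's
`Σ_{k₁>0} k!/(k₁!k₂!) 𝓔^T(Ψ″₁χ,Ψ′₁χ;k₁,k₂)` of (5.31) = `𝓔^T(Y₀+Y₁;k) − 𝓔^T(Y₀;k)`), and those using both `1` and `2`
(print's second term of (5.28), `Σ_{h₂>0,k₂>0} 𝓔^T(Ψ′₁χ,Ψ″₁χ,Ψ₂χ;h₁,h₂,k₂)`, the one bounded by (5.29)).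
[cite: BenfattoEtAl1978, (5.25) p.157, (5.28) p.157, (5.31) p.158] -/
theorem truncExp_three_eq {Y : Fin 3 → Ω → ℝ} {K : ℝ}
    (hYm : ∀ c, AEStronglyMeasurable (Y c) μ) (hYK : ∀ c, ∀ᵐ ω ∂μ, |Y c ω| ≤ K) (n : ℕ) :
    truncExp (fun ω => Y 0 ω + Y 1 ω + Y 2 ω) μ (n + 1) =
      truncExp (fun ω => Y 0 ω + Y 2 ω) μ (n + 1)
        + (truncExp (fun ω => Y 0 ω + Y 1 ω) μ (n + 1) - truncExp (fun ω => Y 0 ω) μ (n + 1))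
        + ∑ f ∈ univ.filter (fun f : Fin (n + 1) → Fin 3 => (∃ j, f j = 1) ∧ ∃ j, f j = 2),
            ursellOf (fun P : Finset (Fin (n + 1)) => ∫ ω, ∏ j ∈ P, Y (f j) ω ∂μ) univ := by
  set g : (Fin (n + 1) → Fin 3) → ℝ :=
    fun f => ursellOf (fun P : Finset (Fin (n + 1)) => ∫ ω, ∏ j ∈ P, Y (f j) ω ∂μ) univ with hg
  have m02 : ∀ x : Fin 3, x ∈ ({0, 2} : Finset (Fin 3)) ↔ ¬x = 1 := by decide
  have m01 : ∀ x : Fin 3, x ∈ ({0, 1} : Finset (Fin 3)) ↔ ¬x = 2 := by decide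
  have m0 : ∀ x : Fin 3, x ∈ ({0} : Finset (Fin 3)) ↔ ¬x = 1 ∧ ¬x = 2 := by decide
  -- the four sub-sums as filtered colouring sums
  have hA : truncExp (fun ω => Y 0 ω + Y 1 ω + Y 2 ω) μ (n + 1) = ∑ f, g f := by
    have h := truncExp_finsetSum_eq_sum_filter (μ := μ) (S := (univ : Finset (Fin 3)))
      Finset.univ_nonempty hYm hYK n
    have hfun : (fun ω => ∑ c ∈ (univ : Finset (Fin 3)), Y c ω) = fun ω => Y 0 ω + Y 1 ω + Y 2 ω := by
      funext ω
      simp [Fin.sum_univ_three]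
    rw [hfun] at h
    rw [h, Finset.filter_true_of_mem fun f _ j => mem_univ (f j)]
  have hB : truncExp (fun ω => Y 0 ω + Y 2 ω) μ (n + 1) =
      ∑ f ∈ univ.filter (fun f : Fin (n + 1) → Fin 3 => ¬∃ j, f j = 1), g f := by
    have h := truncExp_finsetSum_eq_sum_filter (μ := μ) (S := ({0, 2} : Finset (Fin 3)))
      ⟨0, by simp⟩ hYm hYK n
    have hfun : (fun ω => ∑ c ∈ ({0, 2} : Finset (Fin 3)), Y c ω) = fun ω => Y 0 ω + Y 2 ω := by
      funext ω
      rw [Finset.sum_pair (by decide)]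
    rw [hfun] at h
    rw [h]
    refine Finset.sum_congr (Finset.filter_congr fun f _ => ?_) fun _ _ => rfl
    simp only [m02, not_exists]
  have hC : truncExp (fun ω => Y 0 ω + Y 1 ω) μ (n + 1) =
      ∑ f ∈ univ.filter (fun f : Fin (n + 1) → Fin 3 => ¬∃ j, f j = 2), g f := by
    have h := truncExp_finsetSum_eq_sum_filter (μ := μ) (S := ({0, 1} : Finset (Fin 3)))
      ⟨0, by simp⟩ hYm hYK n
    have hfun : (fun ω => ∑ c ∈ ({0, 1} : Finset (Fin 3)), Y c ω) = fun ω => Y 0 ω + Y 1 ω := by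
      funext ω
      rw [Finset.sum_pair (by decide)]
    rw [hfun] at h
    rw [h]
    refine Finset.sum_congr (Finset.filter_congr fun f _ => ?_) fun _ _ => rfl
    simp only [m01, not_exists]
  have hD : truncExp (fun ω => Y 0 ω) μ (n + 1) =
      ∑ f ∈ univ.filter (fun f : Fin (n + 1) → Fin 3 => (¬∃ j, f j = 1) ∧ ¬∃ j, f j = 2), g f := by
    have h := truncExp_finsetSum_eq_sum_filter (μ := μ) (S := ({0} : Finset (Fin 3)))
      ⟨0, by simp⟩ hYm hYK n
    have hfun : (fun ω => ∑ c ∈ ({0} : Finset (Fin 3)), Y c ω) = fun ω => Y 0 ω := by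
      funext ω
      rw [Finset.sum_singleton]
    rw [hfun] at h
    rw [h]
    refine Finset.sum_congr (Finset.filter_congr fun f _ => ?_) fun _ _ => rfl
    simp only [m0, forall_and, not_exists]
  have hIE := sum_filter_and_incl_excl (univ : Finset (Fin (n + 1) → Fin 3)) (fun f => ∃ j, f j = 1)
    (fun f => ∃ j, f j = 2) g
  rw [hA, hB, hC, hD]
  linarith [hIE]

/-- **(5.31), first line** («We now write 𝓔^T(χΨ₁;k) = 𝓔^T(χΨ′₁;k) + Σ_{k₁+k₂=k, k₁>0} k!/(k₁!k₂!)
𝓔^T(χΨ″₁, χΨ′₁; k₁, k₂)»): `𝓔^T(Y₀+Y₁; k) − 𝓔^T(Y₀; k)` is the sum of the joint truncated expectations over the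
colourings using the colour `1` and avoiding `2`. [cite: BenfattoEtAl1978, (5.31) p.158] -/
theorem truncExp_two_sub_eq {Y : Fin 3 → Ω → ℝ} {K : ℝ}
    (hYm : ∀ c, AEStronglyMeasurable (Y c) μ) (hYK : ∀ c, ∀ᵐ ω ∂μ, |Y c ω| ≤ K) (n : ℕ) :
    truncExp (fun ω => Y 0 ω + Y 1 ω) μ (n + 1) - truncExp (fun ω => Y 0 ω) μ (n + 1) =
      ∑ f ∈ univ.filter (fun f : Fin (n + 1) → Fin 3 => (∃ j, f j = 1) ∧ ∀ j, f j ≠ 2),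
        ursellOf (fun P : Finset (Fin (n + 1)) => ∫ ω, ∏ j ∈ P, Y (f j) ω ∂μ) univ := by
  set g : (Fin (n + 1) → Fin 3) → ℝ :=
    fun f => ursellOf (fun P : Finset (Fin (n + 1)) => ∫ ω, ∏ j ∈ P, Y (f j) ω ∂μ) univ with hg
  have m01 : ∀ x : Fin 3, x ∈ ({0, 1} : Finset (Fin 3)) ↔ ¬x = 2 := by decide
  have m0 : ∀ x : Fin 3, x ∈ ({0} : Finset (Fin 3)) ↔ ¬x = 2 ∧ ¬x = 1 := by decide
  have hC : truncExp (fun ω => Y 0 ω + Y 1 ω) μ (n + 1) =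
      ∑ f ∈ univ.filter (fun f : Fin (n + 1) → Fin 3 => ∀ j, f j ≠ 2), g f := by
    have h := truncExp_finsetSum_eq_sum_filter (μ := μ) (S := ({0, 1} : Finset (Fin 3)))
      ⟨0, by simp⟩ hYm hYK n
    have hfun : (fun ω => ∑ c ∈ ({0, 1} : Finset (Fin 3)), Y c ω) = fun ω => Y 0 ω + Y 1 ω := by
      funext ω
      rw [Finset.sum_pair (by decide)]
    rw [hfun] at h
    rw [h]
    refine Finset.sum_congr (Finset.filter_congr fun f _ => ?_) fun _ _ => rfl
    simp only [m01, ne_eq]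
  have hD : truncExp (fun ω => Y 0 ω) μ (n + 1) =
      ∑ f ∈ univ.filter (fun f : Fin (n + 1) → Fin 3 => (∀ j, f j ≠ 2) ∧ ¬∃ j, f j = 1), g f := by
    have h := truncExp_finsetSum_eq_sum_filter (μ := μ) (S := ({0} : Finset (Fin 3)))
      ⟨0, by simp⟩ hYm hYK n
    have hfun : (fun ω => ∑ c ∈ ({0} : Finset (Fin 3)), Y c ω) = fun ω => Y 0 ω := by
      funext ω
      rw [Finset.sum_singleton]
    rw [hfun] at h
    rw [h]
    refine Finset.sum_congr (Finset.filter_congr fun f _ => ?_) fun _ _ => rfl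
    simp only [m0, forall_and, not_exists, ne_eq]
  have h2 := Finset.sum_filter_add_sum_filter_not (univ.filter fun f : Fin (n + 1) → Fin 3 => ∀ j, f j ≠ 2)
    (fun f => ∃ j, f j = 1) g
  rw [Finset.filter_filter, Finset.filter_filter] at h2
  have e1 : univ.filter (fun f : Fin (n + 1) → Fin 3 => (∀ j, f j ≠ 2) ∧ ∃ j, f j = 1) =
      univ.filter (fun f : Fin (n + 1) → Fin 3 => (∃ j, f j = 1) ∧ ∀ j, f j ≠ 2) :=
    Finset.filter_congr fun x _ => and_comm
  rw [e1] at h2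
  rw [hC, hD]
  linarith [h2]

/-- COUNTING: a sum over a filtered set of colourings `f : σ → Fin 3`, each term bounded by `δ`, is bounded by `3^{|σ|}·δ`
— print's unspecified combinatorial constants («s_k … are positive constants», «has the same form of (5.29) with new
constants», p. 158): at most `3^k` colourings of `k` slots by three pieces. [cite: BenfattoEtAl1978, (5.29) p.158] -/
theorem abs_sum_filter_le_three_pow {g : (σ → Fin 3) → ℝ} {δ : ℝ} (p : (σ → Fin 3) → Prop) [DecidablePred p]
    (hδ : 0 ≤ δ) (hg : ∀ f, p f → |g f| ≤ δ) :
    |∑ f ∈ univ.filter p, g f| ≤ 3 ^ Fintype.card σ * δ := by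
  refine (Finset.abs_sum_le_sum_abs _ _).trans ?_
  calc ∑ f ∈ univ.filter p, |g f| ≤ ∑ _f ∈ univ.filter p, δ :=
        Finset.sum_le_sum fun f hf => hg f (Finset.mem_filter.1 hf).2
    _ = ((univ.filter p).card : ℝ) * δ := by rw [Finset.sum_const, nsmul_eq_mul]
    _ ≤ 3 ^ Fintype.card σ * δ := by
        refine mul_le_mul_of_nonneg_right ?_ hδ
        calc ((univ.filter p).card : ℝ) ≤ ((univ : Finset (σ → Fin 3)).card : ℝ) := by
              exact_mod_cast Finset.card_filter_le _ _
          _ = 3 ^ Fintype.card σ := by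
              rw [Finset.card_univ, Fintype.card_fun, Fintype.card_fin]
              push_cast
              rfl

end Colourings

/-! ## §2  The two brackets between `∫ e^{Xχ} dP̄` and `∫ χ e^{Xχ} dP̄` in log form ((5.18) read both ways) -/

section Brackets

variable {Ω : Type*} {mΩ : MeasurableSpace Ω} {μ : Measure Ω}

/-- `e^{X}` is integrable on a finite measure space when `|X| ≤ K` a.e. [folklore] -/
private theorem integrable_exp_of_ae_abs_le [IsFiniteMeasure μ] {X : Ω → ℝ} {K : ℝ} (hXm : AEMeasurable X μ)
    (hXK : ∀ᵐ ω ∂μ, |X ω| ≤ K) : Integrable (fun ω => Real.exp (X ω)) μ :=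
  Integrable.mono' (integrable_const (Real.exp K))
    (Real.measurable_exp.comp_aemeasurable hXm).aestronglyMeasurable (hXK.mono fun ω hω => by
      rw [Real.norm_eq_abs, abs_of_pos (Real.exp_pos _)]
      exact Real.exp_le_exp.2 (abs_le.1 hω).2)

/-- `χ·e^{X}` is integrable for a weight `0 ≤ χ ≤ 1` and `|X| ≤ K` a.e. [folklore] -/
private theorem integrable_mul_exp_of_ae_abs_le [IsFiniteMeasure μ] {χ X : Ω → ℝ} {K : ℝ}
    (hχm : Measurable χ) (hχ0 : ∀ ω, 0 ≤ χ ω) (hχ1 : ∀ ω, χ ω ≤ 1)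
    (hXm : AEMeasurable X μ) (hXK : ∀ᵐ ω ∂μ, |X ω| ≤ K) :
    Integrable (fun ω => χ ω * Real.exp (X ω)) μ :=
  Integrable.mono' (integrable_exp_of_ae_abs_le hXm hXK) (hχm.aestronglyMeasurable.mul
      (Real.measurable_exp.comp_aemeasurable hXm).aestronglyMeasurable) (ae_of_all _ fun ω => by
    rw [Real.norm_eq_abs, abs_mul, abs_of_nonneg (hχ0 ω), abs_of_pos (Real.exp_pos _)]
    exact mul_le_of_le_one_left (Real.exp_pos _).le (hχ1 ω))

/-- The lower a-priori bracket `e^{−K}·∫χ ≤ ∫ χe^{X}`; in particular `∫ χe^{X} > 0` as soon as `∫χ > 0`. [folklore] -/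
private theorem exp_neg_mul_integral_le_integral_mul_exp [IsFiniteMeasure μ] {χ X : Ω → ℝ} {K : ℝ}
    (hχm : Measurable χ) (hχ0 : ∀ ω, 0 ≤ χ ω) (hχ1 : ∀ ω, χ ω ≤ 1)
    (hXm : AEMeasurable X μ) (hXK : ∀ᵐ ω ∂μ, |X ω| ≤ K) :
    Real.exp (-K) * ∫ ω, χ ω ∂μ ≤ ∫ ω, χ ω * Real.exp (X ω) ∂μ := by
  have hχInt : Integrable χ μ :=
    Integrable.mono' (integrable_const (1 : ℝ)) hχm.aestronglyMeasurable (ae_of_all _ fun ω => by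
      rw [Real.norm_eq_abs, abs_of_nonneg (hχ0 ω)]
      exact hχ1 ω)
  rw [← integral_const_mul]
  refine integral_mono_ae (hχInt.const_mul _) (integrable_mul_exp_of_ae_abs_le hχm hχ0 hχ1 hXm hXK)
    (hXK.mono fun ω hω => ?_)
  have h1 : Real.exp (-K) ≤ Real.exp (X ω) := Real.exp_le_exp.2 (abs_le.1 hω).1
  have h2 := hχ0 ω
  nlinarith

/-- **(5.36), first step**: `log ∫ χe^{X} dP̄ ≤ log ∫ e^{X} dP̄` (`0 ≤ χ ≤ 1`, `|X| ≤ K` a.e., `∫χ ≥ e^{−W} > 0` so that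
both integrals are positive) — the upper bound starts by dropping `χ_b^□` in front of `exp Ψ_□χ_b^□` («We start from
(5.13), then …» (5.36), whose last product carries no `χ_b^□`). [cite: BenfattoEtAl1978, (5.36) p.159] -/
theorem log_integral_mul_exp_le_log_integral_exp [IsProbabilityMeasure μ] {χ X : Ω → ℝ} {K W : ℝ}
    (hχm : Measurable χ) (hχ0 : ∀ ω, 0 ≤ χ ω) (hχ1 : ∀ ω, χ ω ≤ 1)
    (hXm : AEMeasurable X μ) (hXK : ∀ᵐ ω ∂μ, |X ω| ≤ K) (hW : Real.exp (-W) ≤ ∫ ω, χ ω ∂μ) :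
    Real.log (∫ ω, χ ω * Real.exp (X ω) ∂μ) ≤ Real.log (∫ ω, Real.exp (X ω) ∂μ) := by
  have hpos : 0 < ∫ ω, χ ω * Real.exp (X ω) ∂μ :=
    lt_of_lt_of_le (mul_pos (Real.exp_pos _) ((Real.exp_pos _).trans_le hW))
      (exp_neg_mul_integral_le_integral_mul_exp hχm hχ0 hχ1 hXm hXK)
  refine Real.log_le_log hpos (integral_mono (integrable_mul_exp_of_ae_abs_le hχm hχ0 hχ1 hXm hXK)
    (integrable_exp_of_ae_abs_le hXm hXK) fun ω => ?_)
  exact mul_le_of_le_one_left (Real.exp_pos _).le (hχ1 ω)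

/-- **(5.18) READ UPWARD** («attributing to the various τ the value opposite», p. 159): for a probability measure, a
weight `0 ≤ χ ≤ 1`, `|X| ≤ K` a.e. and a volume input `e^{−W} ≤ ∫χ dP̄`,
`log ∫ e^{X} dP̄ ≤ log ∫ χe^{X} dP̄ + e^{2K}·W` — the logarithm of
`B1Eq324BenfattoSect5Cumulant.integral_exp_mul_rpow_le_integral_mul_exp`.
[cite: BenfattoEtAl1978, (5.18) p.156 and (5.36) p.159] -/
theorem log_integral_exp_le_log_integral_mul_exp_add [IsProbabilityMeasure μ] {χ X : Ω → ℝ} {K W : ℝ}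
    (hχm : Measurable χ) (hχ0 : ∀ ω, 0 ≤ χ ω) (hχ1 : ∀ ω, χ ω ≤ 1)
    (hXm : AEMeasurable X μ) (hXK : ∀ᵐ ω ∂μ, |X ω| ≤ K) (hW : Real.exp (-W) ≤ ∫ ω, χ ω ∂μ) :
    Real.log (∫ ω, Real.exp (X ω) ∂μ) ≤ Real.log (∫ ω, χ ω * Real.exp (X ω) ∂μ) + Real.exp (2 * K) * W := by
  have h := integral_exp_mul_rpow_le_integral_mul_exp hχm hχ0 hχ1 hXm hXK
  have hpos : 0 < ∫ ω, χ ω ∂μ := (Real.exp_pos _).trans_le hW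
  have hI : 0 < ∫ ω, Real.exp (X ω) ∂μ := integral_exp_pos (integrable_exp_of_ae_abs_le hXm hXK)
  have hpc : 0 < (∫ ω, χ ω ∂μ) ^ Real.exp (2 * K) := Real.rpow_pos_of_pos hpos _
  have hlog := Real.log_le_log (mul_pos hI hpc) h
  rw [Real.log_mul hI.ne' hpc.ne', Real.log_rpow hpos] at hlog
  have hvol : -W ≤ Real.log (∫ ω, χ ω ∂μ) := (Real.le_log_iff_exp_le hpos).2 hW
  have hc : 0 ≤ Real.exp (2 * K) := (Real.exp_pos _).le
  nlinarith [mul_le_mul_of_nonneg_left hvol hc]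

end Brackets

/-! ## §3  The per-box relation (5.30)→(5.33), lower bound, and its «τ opposite» upper twin (5.36) -/

section PerBox

variable {Ω : Type*} {mΩ : MeasurableSpace Ω} {μ : Measure Ω} [IsProbabilityMeasure μ]

/-- **PER ORDER `k`: (5.25)–(5.26) + (5.28)–(5.29) + (5.31)** — four pieces `Ψ = Y₀ + Y₁ + Y₂ + D` (print: `Y₀ = Ψ′₁`,
`Y₁ = Ψ″₁`, `Y₂ = Ψ₂`, `D = Ψ₃ = H′^{(l)}`), a weight `χ` (print: `χ_b^□`), with `|Y_cχ|, |(Y₀+Y₁)χ| ≤ K`, `|Dχ| ≤ ε ≤ K`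
a.e. (print: `K = s₂Ab^{D+2d}` by (5.15) i), `ε = s₁Ab^{D+2d}e^{−ϰb^{3/2}/8}` by (5.24)); and SUM-LEVEL inputs for the
two analytic suppliers: (5.29) `|Σ_{f uses 1∧2} 𝓔^T((Yχ)_f)| ≤ E₂₉` and (5.31) `|Σ_{f uses 1, avoids 2} 𝓔^T((Yχ)_f) − e₀|
≤ E₃₁` (`e₀` = print's `Σ_{k₁>0} k!/(k₁!k₂!) Ê₀^T(Ψ″₁,Ψ′₁;k₁,k₂)`, a number not depending on the conditioning).  Then
`|𝓔^T(Ψχ; k) − 𝓔^T((Y₀+Y₂)χ; k) − e₀| ≤ 3^k·(Σ_{π∈𝒫(k)}(|π|−1)!)·ε·K^{k−1} + E₂₉ + E₃₁`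
— (5.26) by `B1Eq324BenfattoSect5JointCumulants.eq526_three`, the rest by `truncExp_three_eq` / `truncExp_two_sub_eq`.
[cite: BenfattoEtAl1978, (5.25)–(5.31) pp.157–158] -/
theorem abs_truncExp_four_sub_le {Y : Fin 3 → Ω → ℝ} {D χ : Ω → ℝ} {K ε E₂₉ E₃₁ e₀ : ℝ} {k : ℕ}
    (hχm : Measurable χ) (hYm : ∀ c, AEStronglyMeasurable (Y c) μ) (hDm : AEStronglyMeasurable D μ)
    (hYK : ∀ c, ∀ᵐ ω ∂μ, |Y c ω * χ ω| ≤ K) (h01K : ∀ᵐ ω ∂μ, |(Y 0 ω + Y 1 ω) * χ ω| ≤ K)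
    (hDε : ∀ᵐ ω ∂μ, |D ω * χ ω| ≤ ε) (hε0 : 0 ≤ ε) (hεK : ε ≤ K)
    (h29 : |∑ f ∈ univ.filter (fun f : Fin (k + 1) → Fin 3 => (∃ j, f j = 1) ∧ ∃ j, f j = 2),
        ursellOf (fun P : Finset (Fin (k + 1)) => ∫ ω, ∏ j ∈ P, Y (f j) ω * χ ω ∂μ) univ| ≤ E₂₉)
    (h31 : |(∑ f ∈ univ.filter (fun f : Fin (k + 1) → Fin 3 => (∃ j, f j = 1) ∧ ∀ j, f j ≠ 2),
        ursellOf (fun P : Finset (Fin (k + 1)) => ∫ ω, ∏ j ∈ P, Y (f j) ω * χ ω ∂μ) univ) - e₀| ≤ E₃₁) :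
    |truncExp (fun ω => (Y 0 ω + Y 1 ω + Y 2 ω + D ω) * χ ω) μ (k + 1)
        - truncExp (fun ω => (Y 0 ω + Y 2 ω) * χ ω) μ (k + 1) - e₀| ≤
      3 ^ (k + 1) * ((∑ π ∈ setPartitions (univ : Finset (Fin (k + 1))), ((π.card - 1)! : ℝ)) * (ε * K ^ k))
        + E₂₉ + E₃₁ := by
  have hχm' : AEStronglyMeasurable χ μ := hχm.aestronglyMeasurable
  have hZm : ∀ c, AEStronglyMeasurable (fun ω => Y c ω * χ ω) μ := fun c => (hYm c).mul hχm'
  -- (5.26): drop `Dχ`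
  have h26 := eq526_three (σ := Fin (k + 1)) (μ := μ) (X₁ := fun ω => (Y 0 ω + Y 1 ω) * χ ω)
    (X₂ := fun ω => Y 2 ω * χ ω) (X₃ := fun ω => D ω * χ ω) (K := K) (ε := ε)
    (((hYm 0).add (hYm 1)).mul hχm') (hZm 2) (hDm.mul hχm') h01K (hYK 2) hDε hε0 hεK
  have e4 : (fun ω => (Y 0 ω + Y 1 ω) * χ ω + Y 2 ω * χ ω + D ω * χ ω) =
      fun ω => (Y 0 ω + Y 1 ω + Y 2 ω + D ω) * χ ω := by
    funext ω; ring
  have e3 : (fun ω => (Y 0 ω + Y 1 ω) * χ ω + Y 2 ω * χ ω) =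
      fun ω => Y 0 ω * χ ω + Y 1 ω * χ ω + Y 2 ω * χ ω := by
    funext ω; ring
  rw [e4, e3, Fintype.card_fin] at h26
  -- (5.25)/(5.28)/(5.31): the three-piece identity for the family `Y_cχ`
  have h3 := truncExp_three_eq (μ := μ) (Y := fun c ω => Y c ω * χ ω) hZm hYK k
  have h2 := truncExp_two_sub_eq (μ := μ) (Y := fun c ω => Y c ω * χ ω) hZm hYK k
  beta_reduce at h3 h2
  have e02 : (fun ω => Y 0 ω * χ ω + Y 2 ω * χ ω) = fun ω => (Y 0 ω + Y 2 ω) * χ ω := by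
    funext ω; ring
  rw [e02, h2] at h3
  -- restate with the literal sums of the hypotheses (same terms, fixed elaboration)
  have h3' : truncExp (fun ω => Y 0 ω * χ ω + Y 1 ω * χ ω + Y 2 ω * χ ω) μ (k + 1) =
      truncExp (fun ω => (Y 0 ω + Y 2 ω) * χ ω) μ (k + 1)
        + (∑ f ∈ univ.filter (fun f : Fin (k + 1) → Fin 3 => (∃ j, f j = 1) ∧ ∀ j, f j ≠ 2),
            ursellOf (fun P : Finset (Fin (k + 1)) => ∫ ω, ∏ j ∈ P, Y (f j) ω * χ ω ∂μ) univ)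
        + ∑ f ∈ univ.filter (fun f : Fin (k + 1) → Fin 3 => (∃ j, f j = 1) ∧ ∃ j, f j = 2),
            ursellOf (fun P : Finset (Fin (k + 1)) => ∫ ω, ∏ j ∈ P, Y (f j) ω * χ ω ∂μ) univ := h3
  -- combine
  set T4 := truncExp (fun ω => (Y 0 ω + Y 1 ω + Y 2 ω + D ω) * χ ω) μ (k + 1) with hT4
  set T3 := truncExp (fun ω => Y 0 ω * χ ω + Y 1 ω * χ ω + Y 2 ω * χ ω) μ (k + 1) with hT3
  set T2 := truncExp (fun ω => (Y 0 ω + Y 2 ω) * χ ω) μ (k + 1) with hT2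
  set S31 := ∑ f ∈ univ.filter (fun f : Fin (k + 1) → Fin 3 => (∃ j, f j = 1) ∧ ∀ j, f j ≠ 2),
      ursellOf (fun P : Finset (Fin (k + 1)) => ∫ ω, ∏ j ∈ P, Y (f j) ω * χ ω ∂μ) univ with hS31
  set S29 := ∑ f ∈ univ.filter (fun f : Fin (k + 1) → Fin 3 => (∃ j, f j = 1) ∧ ∃ j, f j = 2),
      ursellOf (fun P : Finset (Fin (k + 1)) => ∫ ω, ∏ j ∈ P, Y (f j) ω * χ ω ∂μ) univ with hS29
  have key : T4 - T2 - e₀ = (T4 - T3) + (S31 - e₀) + S29 := by rw [h3']; ring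
  rw [key]
  refine (abs_add_three _ _ _).trans ?_
  rw [Nat.add_sub_cancel] at h26
  linarith [h26, h29, h31]

/-- **(5.30)→(5.33), THE PER-BOX LOWER BOUND** — for ONE box: a probability measure `P̄` (print: `P̄(dz_□|z_{Γ₁})`), a weight
`0 ≤ χ ≤ 1` with volume `∫χ ≥ e^{−W}` (print: `χ_b^□`, `W = 3b^{2d}e^{−b²/4}` by (5.19)), pieces `Ψ = Y₀+Y₁+Y₂+D` as in
`abs_truncExp_four_sub_le` with every partial exponent bounded by the same `K` (print's point i)), and the sum-level inputs
(5.29)/(5.31) at each order `k ≤ t`.  Then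
`log ∫χe^{Ψχ}dP̄ ≥ log ∫χe^{(Y₀+Y₂)χ}dP̄ + Σ_{k≤t} e₀(k)/k! − [2·2^{C(t+1,2)}K^{t+1}/(t+1)! + e^{2K}W
+ Σ_{k≤t}(3^k s_k εK^{k−1} + E₂₉(k) + E₃₁(k))/k!]`: (5.22) (`sum_sub_sub_le_log_integral_mul_exp`) expands `log∫χe^{Ψχ}`
in `𝓔^T(Ψχ;k)`, `abs_truncExp_four_sub_le` trades each for `𝓔^T((Y₀+Y₂)χ;k) + e₀(k)`, and «the cumulant formula backwards»
(5.33) (`abs_log_integral_exp_sub_sum_le` + `∫e^{Xχ} ≥ ∫χe^{Xχ}`) re-sums them into `log∫χe^{(Ψ′₁+Ψ₂)χ}` — print's factor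
`∫P̄(dz_□|z_{Γ₁})χ_□^b exp(H_{Γ₂(□)∪Γ₄(□)} + H_{Γ₂(□),Γ₁(□)} − H_{Γ₄(□),Γ₂(□)∖Γ₃(□)})` of (5.33) times
`exp[Σ 1/(k₁!k₂!) Ê₀^T(Ψ″₁,Ψ′₁;k₁,k₂)]` of (5.32), up to `exp(error)`. [cite: BenfattoEtAl1978, (5.30)–(5.33) pp.158–159] -/
theorem eq530_lower {Y : Fin 3 → Ω → ℝ} {D χ : Ω → ℝ} {K ε W : ℝ} {t : ℕ} {E₂₉ E₃₁ e₀ : ℕ → ℝ}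
    (hχm : Measurable χ) (hχ0 : ∀ ω, 0 ≤ χ ω) (hχ1 : ∀ ω, χ ω ≤ 1)
    (hYm : ∀ c, AEStronglyMeasurable (Y c) μ) (hDm : AEStronglyMeasurable D μ)
    (hYK : ∀ c, ∀ᵐ ω ∂μ, |Y c ω * χ ω| ≤ K)
    (h01K : ∀ᵐ ω ∂μ, |(Y 0 ω + Y 1 ω) * χ ω| ≤ K)
    (h02K : ∀ᵐ ω ∂μ, |(Y 0 ω + Y 2 ω) * χ ω| ≤ K)
    (hΨK : ∀ᵐ ω ∂μ, |(Y 0 ω + Y 1 ω + Y 2 ω + D ω) * χ ω| ≤ K)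
    (hDε : ∀ᵐ ω ∂μ, |D ω * χ ω| ≤ ε) (hε0 : 0 ≤ ε) (hεK : ε ≤ K)
    (hW : Real.exp (-W) ≤ ∫ ω, χ ω ∂μ)
    (h29 : ∀ k < t, |∑ f ∈ univ.filter (fun f : Fin (k + 1) → Fin 3 => (∃ j, f j = 1) ∧ ∃ j, f j = 2),
        ursellOf (fun P : Finset (Fin (k + 1)) => ∫ ω, ∏ j ∈ P, Y (f j) ω * χ ω ∂μ) univ| ≤ E₂₉ (k + 1))
    (h31 : ∀ k < t, |(∑ f ∈ univ.filter (fun f : Fin (k + 1) → Fin 3 => (∃ j, f j = 1) ∧ ∀ j, f j ≠ 2),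
        ursellOf (fun P : Finset (Fin (k + 1)) => ∫ ω, ∏ j ∈ P, Y (f j) ω * χ ω ∂μ) univ) - e₀ (k + 1)|
        ≤ E₃₁ (k + 1)) :
    Real.log (∫ ω, χ ω * Real.exp ((Y 0 ω + Y 2 ω) * χ ω) ∂μ)
        + ∑ k ∈ Finset.range t, e₀ (k + 1) / (k + 1)!
        - (2 * (2 ^ ((t + 1).choose 2) * K ^ (t + 1) / (t + 1)!) + Real.exp (2 * K) * W
          + ∑ k ∈ Finset.range t,
              (3 ^ (k + 1) * ((∑ π ∈ setPartitions (univ : Finset (Fin (k + 1))), ((π.card - 1)! : ℝ))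
                * (ε * K ^ k)) + E₂₉ (k + 1) + E₃₁ (k + 1)) / (k + 1)!) ≤
      Real.log (∫ ω, χ ω * Real.exp ((Y 0 ω + Y 1 ω + Y 2 ω + D ω) * χ ω) ∂μ) := by
  have hχm' : AEStronglyMeasurable χ μ := hχm.aestronglyMeasurable
  have hΨm : AEMeasurable (fun ω => (Y 0 ω + Y 1 ω + Y 2 ω + D ω) * χ ω) μ :=
    (((((hYm 0).add (hYm 1)).add (hYm 2)).add hDm).mul hχm').aemeasurable
  have h02m : AEMeasurable (fun ω => (Y 0 ω + Y 2 ω) * χ ω) μ :=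
    (((hYm 0).add (hYm 2)).mul hχm').aemeasurable
  -- (5.22)
  have h522 := sum_sub_sub_le_log_integral_mul_exp hχm hχ0 hχ1 hΨm hΨK hW t
  -- per order
  have hk : ∀ k ∈ Finset.range t,
      (truncExp (fun ω => (Y 0 ω + Y 2 ω) * χ ω) μ (k + 1) + e₀ (k + 1)
          - (3 ^ (k + 1) * ((∑ π ∈ setPartitions (univ : Finset (Fin (k + 1))), ((π.card - 1)! : ℝ))
              * (ε * K ^ k)) + E₂₉ (k + 1) + E₃₁ (k + 1))) / (k + 1)! ≤
        truncExp (fun ω => (Y 0 ω + Y 1 ω + Y 2 ω + D ω) * χ ω) μ (k + 1) / (k + 1)! := by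
    intro k hk
    have hkt : k < t := Finset.mem_range.1 hk
    have h := abs_truncExp_four_sub_le hχm hYm hDm hYK h01K hDε hε0 hεK (h29 k hkt) (h31 k hkt)
    have hf : (0 : ℝ) < (k + 1)! := by positivity
    rw [div_le_div_iff_of_pos_right hf]
    linarith [(abs_le.1 h).1]
  have hS := Finset.sum_le_sum hk
  have hsplit : ∑ k ∈ Finset.range t,
      (truncExp (fun ω => (Y 0 ω + Y 2 ω) * χ ω) μ (k + 1) + e₀ (k + 1)
          - (3 ^ (k + 1) * ((∑ π ∈ setPartitions (univ : Finset (Fin (k + 1))), ((π.card - 1)! : ℝ))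
              * (ε * K ^ k)) + E₂₉ (k + 1) + E₃₁ (k + 1))) / (k + 1)! =
      (∑ k ∈ Finset.range t, truncExp (fun ω => (Y 0 ω + Y 2 ω) * χ ω) μ (k + 1) / (k + 1)!)
        + (∑ k ∈ Finset.range t, e₀ (k + 1) / (k + 1)!)
        - ∑ k ∈ Finset.range t,
            (3 ^ (k + 1) * ((∑ π ∈ setPartitions (univ : Finset (Fin (k + 1))), ((π.card - 1)! : ℝ))
              * (ε * K ^ k)) + E₂₉ (k + 1) + E₃₁ (k + 1)) / (k + 1)! := by
    rw [← Finset.sum_add_distrib, ← Finset.sum_sub_distrib]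
    refine Finset.sum_congr rfl fun k _ => ?_
    ring
  rw [hsplit] at hS
  -- (5.33): the cumulant formula backwards for `(Y₀+Y₂)χ`
  have h533 := abs_log_integral_exp_sub_sum_le h02m h02K t
  have hmono := log_integral_mul_exp_le_log_integral_exp hχm hχ0 hχ1 h02m h02K hW
  linarith [(abs_le.1 h533).1, (abs_le.1 h533).2]

/-- **THE «τ OPPOSITE» UPPER TWIN (5.36)** — under the same hypotheses,
`log ∫χe^{Ψχ}dP̄ ≤ log ∫χe^{(Y₀+Y₂)χ}dP̄ + Σ_{k≤t} e₀(k)/k! + [the same error]`: «By beeing careful in attributing to the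
various τ the value opposite to the one chosen in the estimate (4.7)» (p. 159) — `∫χe^{Ψχ} ≤ ∫e^{Ψχ}`, (5.21) upward, the
per-order trade, (5.21) downward for `(Y₀+Y₂)χ`, and (5.18) read upward (`log_integral_exp_le_log_integral_mul_exp_add`)
to return to `∫χe^{(Y₀+Y₂)χ}`. [cite: BenfattoEtAl1978, (5.36) p.159] -/
theorem eq536_upper {Y : Fin 3 → Ω → ℝ} {D χ : Ω → ℝ} {K ε W : ℝ} {t : ℕ} {E₂₉ E₃₁ e₀ : ℕ → ℝ}
    (hχm : Measurable χ) (hχ0 : ∀ ω, 0 ≤ χ ω) (hχ1 : ∀ ω, χ ω ≤ 1)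
    (hYm : ∀ c, AEStronglyMeasurable (Y c) μ) (hDm : AEStronglyMeasurable D μ)
    (hYK : ∀ c, ∀ᵐ ω ∂μ, |Y c ω * χ ω| ≤ K)
    (h01K : ∀ᵐ ω ∂μ, |(Y 0 ω + Y 1 ω) * χ ω| ≤ K)
    (h02K : ∀ᵐ ω ∂μ, |(Y 0 ω + Y 2 ω) * χ ω| ≤ K)
    (hΨK : ∀ᵐ ω ∂μ, |(Y 0 ω + Y 1 ω + Y 2 ω + D ω) * χ ω| ≤ K)
    (hDε : ∀ᵐ ω ∂μ, |D ω * χ ω| ≤ ε) (hε0 : 0 ≤ ε) (hεK : ε ≤ K)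
    (hW : Real.exp (-W) ≤ ∫ ω, χ ω ∂μ)
    (h29 : ∀ k < t, |∑ f ∈ univ.filter (fun f : Fin (k + 1) → Fin 3 => (∃ j, f j = 1) ∧ ∃ j, f j = 2),
        ursellOf (fun P : Finset (Fin (k + 1)) => ∫ ω, ∏ j ∈ P, Y (f j) ω * χ ω ∂μ) univ| ≤ E₂₉ (k + 1))
    (h31 : ∀ k < t, |(∑ f ∈ univ.filter (fun f : Fin (k + 1) → Fin 3 => (∃ j, f j = 1) ∧ ∀ j, f j ≠ 2),
        ursellOf (fun P : Finset (Fin (k + 1)) => ∫ ω, ∏ j ∈ P, Y (f j) ω * χ ω ∂μ) univ) - e₀ (k + 1)|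
        ≤ E₃₁ (k + 1)) :
    Real.log (∫ ω, χ ω * Real.exp ((Y 0 ω + Y 1 ω + Y 2 ω + D ω) * χ ω) ∂μ) ≤
      Real.log (∫ ω, χ ω * Real.exp ((Y 0 ω + Y 2 ω) * χ ω) ∂μ)
        + ∑ k ∈ Finset.range t, e₀ (k + 1) / (k + 1)!
        + (2 * (2 ^ ((t + 1).choose 2) * K ^ (t + 1) / (t + 1)!) + Real.exp (2 * K) * W
          + ∑ k ∈ Finset.range t,
              (3 ^ (k + 1) * ((∑ π ∈ setPartitions (univ : Finset (Fin (k + 1))), ((π.card - 1)! : ℝ))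
                * (ε * K ^ k)) + E₂₉ (k + 1) + E₃₁ (k + 1)) / (k + 1)!) := by
  have hχm' : AEStronglyMeasurable χ μ := hχm.aestronglyMeasurable
  have hΨm : AEMeasurable (fun ω => (Y 0 ω + Y 1 ω + Y 2 ω + D ω) * χ ω) μ :=
    (((((hYm 0).add (hYm 1)).add (hYm 2)).add hDm).mul hχm').aemeasurable
  have h02m : AEMeasurable (fun ω => (Y 0 ω + Y 2 ω) * χ ω) μ :=
    (((hYm 0).add (hYm 2)).mul hχm').aemeasurable
  -- `∫χe^{Ψχ} ≤ ∫e^{Ψχ}` and (5.21) upward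
  have hmono := log_integral_mul_exp_le_log_integral_exp hχm hχ0 hχ1 hΨm hΨK hW
  have h521 := abs_log_integral_exp_sub_sum_le hΨm hΨK t
  -- per order, upper side
  have hk : ∀ k ∈ Finset.range t,
      truncExp (fun ω => (Y 0 ω + Y 1 ω + Y 2 ω + D ω) * χ ω) μ (k + 1) / (k + 1)! ≤
        (truncExp (fun ω => (Y 0 ω + Y 2 ω) * χ ω) μ (k + 1) + e₀ (k + 1)
          + (3 ^ (k + 1) * ((∑ π ∈ setPartitions (univ : Finset (Fin (k + 1))), ((π.card - 1)! : ℝ))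
              * (ε * K ^ k)) + E₂₉ (k + 1) + E₃₁ (k + 1))) / (k + 1)! := by
    intro k hk
    have hkt : k < t := Finset.mem_range.1 hk
    have h := abs_truncExp_four_sub_le hχm hYm hDm hYK h01K hDε hε0 hεK (h29 k hkt) (h31 k hkt)
    have hf : (0 : ℝ) < (k + 1)! := by positivity
    rw [div_le_div_iff_of_pos_right hf]
    linarith [(abs_le.1 h).2]
  have hS := Finset.sum_le_sum hk
  have hsplit : ∑ k ∈ Finset.range t,
      (truncExp (fun ω => (Y 0 ω + Y 2 ω) * χ ω) μ (k + 1) + e₀ (k + 1)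
          + (3 ^ (k + 1) * ((∑ π ∈ setPartitions (univ : Finset (Fin (k + 1))), ((π.card - 1)! : ℝ))
              * (ε * K ^ k)) + E₂₉ (k + 1) + E₃₁ (k + 1))) / (k + 1)! =
      (∑ k ∈ Finset.range t, truncExp (fun ω => (Y 0 ω + Y 2 ω) * χ ω) μ (k + 1) / (k + 1)!)
        + (∑ k ∈ Finset.range t, e₀ (k + 1) / (k + 1)!)
        + ∑ k ∈ Finset.range t,
            (3 ^ (k + 1) * ((∑ π ∈ setPartitions (univ : Finset (Fin (k + 1))), ((π.card - 1)! : ℝ))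
              * (ε * K ^ k)) + E₂₉ (k + 1) + E₃₁ (k + 1)) / (k + 1)! := by
    rw [← Finset.sum_add_distrib, ← Finset.sum_add_distrib]
    refine Finset.sum_congr rfl fun k _ => ?_
    ring
  rw [hsplit] at hS
  -- (5.21) downward for `(Y₀+Y₂)χ` and (5.18) read upward
  have h533 := abs_log_integral_exp_sub_sum_le h02m h02K t
  have hup := log_integral_exp_le_log_integral_mul_exp_add hχm hχ0 hχ1 h02m h02K hW
  linarith [(abs_le.1 h521).1, (abs_le.1 h521).2, (abs_le.1 h533).1, (abs_le.1 h533).2]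

end PerBox

/-! ## §4  Two-sided form, print's indicator form, and the per-colouring entry point -/

section TwoSided

variable {Ω : Type*} {mΩ : MeasurableSpace Ω} {μ : Measure Ω} [IsProbabilityMeasure μ]

/-- **THE PER-BOX RELATION, TWO-SIDED**: under the hypotheses of `eq530_lower` / `eq536_upper`,
`|log ∫χe^{Ψχ}dP̄ − log ∫χe^{(Y₀+Y₂)χ}dP̄ − Σ_{k≤t} e₀(k)/k!| ≤ 2·2^{C(t+1,2)}K^{t+1}/(t+1)! + e^{2K}W
+ Σ_{k≤t}(3^k s_k εK^{k−1} + E₂₉(k) + E₃₁(k))/k!` — «The error has the same form as the one appearing in the text of the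
lemma [Equation (4.6)] with different values of the constants» (p. 158): a `(t+1)`-st-order remainder, a small-field volume
term, and per-order exponentially small terms. [cite: BenfattoEtAl1978, (5.30) p.158 and (5.36) p.159] -/
theorem abs_log_integral_perBox_le {Y : Fin 3 → Ω → ℝ} {D χ : Ω → ℝ} {K ε W : ℝ} {t : ℕ} {E₂₉ E₃₁ e₀ : ℕ → ℝ}
    (hχm : Measurable χ) (hχ0 : ∀ ω, 0 ≤ χ ω) (hχ1 : ∀ ω, χ ω ≤ 1)
    (hYm : ∀ c, AEStronglyMeasurable (Y c) μ) (hDm : AEStronglyMeasurable D μ)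
    (hYK : ∀ c, ∀ᵐ ω ∂μ, |Y c ω * χ ω| ≤ K)
    (h01K : ∀ᵐ ω ∂μ, |(Y 0 ω + Y 1 ω) * χ ω| ≤ K)
    (h02K : ∀ᵐ ω ∂μ, |(Y 0 ω + Y 2 ω) * χ ω| ≤ K)
    (hΨK : ∀ᵐ ω ∂μ, |(Y 0 ω + Y 1 ω + Y 2 ω + D ω) * χ ω| ≤ K)
    (hDε : ∀ᵐ ω ∂μ, |D ω * χ ω| ≤ ε) (hε0 : 0 ≤ ε) (hεK : ε ≤ K)
    (hW : Real.exp (-W) ≤ ∫ ω, χ ω ∂μ)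
    (h29 : ∀ k < t, |∑ f ∈ univ.filter (fun f : Fin (k + 1) → Fin 3 => (∃ j, f j = 1) ∧ ∃ j, f j = 2),
        ursellOf (fun P : Finset (Fin (k + 1)) => ∫ ω, ∏ j ∈ P, Y (f j) ω * χ ω ∂μ) univ| ≤ E₂₉ (k + 1))
    (h31 : ∀ k < t, |(∑ f ∈ univ.filter (fun f : Fin (k + 1) → Fin 3 => (∃ j, f j = 1) ∧ ∀ j, f j ≠ 2),
        ursellOf (fun P : Finset (Fin (k + 1)) => ∫ ω, ∏ j ∈ P, Y (f j) ω * χ ω ∂μ) univ) - e₀ (k + 1)|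
        ≤ E₃₁ (k + 1)) :
    |Real.log (∫ ω, χ ω * Real.exp ((Y 0 ω + Y 1 ω + Y 2 ω + D ω) * χ ω) ∂μ)
        - Real.log (∫ ω, χ ω * Real.exp ((Y 0 ω + Y 2 ω) * χ ω) ∂μ)
        - ∑ k ∈ Finset.range t, e₀ (k + 1) / (k + 1)!| ≤
      2 * (2 ^ ((t + 1).choose 2) * K ^ (t + 1) / (t + 1)!) + Real.exp (2 * K) * W
        + ∑ k ∈ Finset.range t,
            (3 ^ (k + 1) * ((∑ π ∈ setPartitions (univ : Finset (Fin (k + 1))), ((π.card - 1)! : ℝ))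
              * (ε * K ^ k)) + E₂₉ (k + 1) + E₃₁ (k + 1)) / (k + 1)! := by
  have hlo := eq530_lower hχm hχ0 hχ1 hYm hDm hYK h01K h02K hΨK hDε hε0 hεK hW h29 h31
  have hup := eq536_upper hχm hχ0 hχ1 hYm hDm hYK h01K h02K hΨK hDε hε0 hεK hW h29 h31
  rw [abs_le]
  constructor <;> linarith

omit [IsProbabilityMeasure μ] in
/-- For an INDICATOR weight (`χ ∈ {0,1}`, print's `χ_b^□`) the cut exponent is invisible under the weight:
`χ·e^{Xχ} = χ·e^{X}` — so `∫χe^{(Ψ′₁+Ψ₂)χ}` IS print's `∫P̄ χ_□^b exp(H_{Γ₂∪Γ₄} + H_{Γ₂,Γ₁} − H_{Γ₄,Γ₂∖Γ₃})` of (5.33).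
[cite: BenfattoEtAl1978, (5.33) p.159] -/
theorem integral_mul_exp_mul_eq_of_indicator {χ X : Ω → ℝ} (hχ : ∀ ω, χ ω = 0 ∨ χ ω = 1) :
    ∫ ω, χ ω * Real.exp (X ω * χ ω) ∂μ = ∫ ω, χ ω * Real.exp (X ω) ∂μ := by
  refine integral_congr_ae (ae_of_all _ fun ω => ?_)
  rcases hχ ω with h | h
  · simp only [h, zero_mul]
  · simp only [h, mul_one]

/-- **PRINT'S FORM (indicator weight)**: for a measurable small-field EVENT `S` with `P̄(S) ≥ e^{−W}` and pieces bounded ON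
`S` (`|Y_c|, |Y₀+Y₁|, |Y₀+Y₂|, |Ψ| ≤ K`, `|D| ≤ ε ≤ K` on `S` — print's point i) and (5.24) hold under `χ_b^□`), with the
sum-level inputs (5.29)/(5.31) for the slots `Y_c·𝟙_S`:
`|log ∫_S e^{Ψ}dP̄ − log ∫_S e^{Y₀+Y₂}dP̄ − Σ_{k≤t} e₀(k)/k!| ≤ [the error of abs_log_integral_perBox_le]` — the logarithm
of (5.30)/(5.32)–(5.33) for one box `□` with `□ ∩ J ≠ ∅`, and of its upper twin (5.36).
[cite: BenfattoEtAl1978, (5.30)–(5.33) pp.158–159 and (5.36) p.159] -/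
theorem abs_log_setIntegral_perBox_le {Y : Fin 3 → Ω → ℝ} {D : Ω → ℝ} {S : Set Ω} {K ε W : ℝ} {t : ℕ}
    {E₂₉ E₃₁ e₀ : ℕ → ℝ} (hS : MeasurableSet S)
    (hYm : ∀ c, AEStronglyMeasurable (Y c) μ) (hDm : AEStronglyMeasurable D μ)
    (hYK : ∀ c, ∀ ω ∈ S, |Y c ω| ≤ K)
    (h01K : ∀ ω ∈ S, |Y 0 ω + Y 1 ω| ≤ K) (h02K : ∀ ω ∈ S, |Y 0 ω + Y 2 ω| ≤ K)
    (hΨK : ∀ ω ∈ S, |Y 0 ω + Y 1 ω + Y 2 ω + D ω| ≤ K)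
    (hDε : ∀ ω ∈ S, |D ω| ≤ ε) (hε0 : 0 ≤ ε) (hεK : ε ≤ K)
    (hW : Real.exp (-W) ≤ μ.real S)
    (h29 : ∀ k < t, |∑ f ∈ univ.filter (fun f : Fin (k + 1) → Fin 3 => (∃ j, f j = 1) ∧ ∃ j, f j = 2),
        ursellOf (fun P : Finset (Fin (k + 1)) => ∫ ω, ∏ j ∈ P, Y (f j) ω * S.indicator 1 ω ∂μ) univ|
        ≤ E₂₉ (k + 1))
    (h31 : ∀ k < t, |(∑ f ∈ univ.filter (fun f : Fin (k + 1) → Fin 3 => (∃ j, f j = 1) ∧ ∀ j, f j ≠ 2),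
        ursellOf (fun P : Finset (Fin (k + 1)) => ∫ ω, ∏ j ∈ P, Y (f j) ω * S.indicator 1 ω ∂μ) univ)
        - e₀ (k + 1)| ≤ E₃₁ (k + 1)) :
    |Real.log (∫ ω in S, Real.exp (Y 0 ω + Y 1 ω + Y 2 ω + D ω) ∂μ)
        - Real.log (∫ ω in S, Real.exp (Y 0 ω + Y 2 ω) ∂μ)
        - ∑ k ∈ Finset.range t, e₀ (k + 1) / (k + 1)!| ≤
      2 * (2 ^ ((t + 1).choose 2) * K ^ (t + 1) / (t + 1)!) + Real.exp (2 * K) * W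
        + ∑ k ∈ Finset.range t,
            (3 ^ (k + 1) * ((∑ π ∈ setPartitions (univ : Finset (Fin (k + 1))), ((π.card - 1)! : ℝ))
              * (ε * K ^ k)) + E₂₉ (k + 1) + E₃₁ (k + 1)) / (k + 1)! := by
  set χ : Ω → ℝ := S.indicator 1 with hχ
  have hχm : Measurable χ := measurable_one.indicator hS
  have hχ0 : ∀ ω, 0 ≤ χ ω := fun ω => Set.indicator_nonneg (fun _ _ => zero_le_one) ω
  have hχ1 : ∀ ω, χ ω ≤ 1 := fun ω => Set.indicator_le_self' (fun _ _ => zero_le_one) ω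
  have hχ01 : ∀ ω, χ ω = 0 ∨ χ ω = 1 := fun ω => by
    by_cases h : ω ∈ S
    · exact Or.inr (by simp [hχ, h])
    · exact Or.inl (by simp [hχ, h])
  have hK0 : 0 ≤ K := hε0.trans hεK
  -- a bound on `S` is an everywhere bound after the cut
  have cut : ∀ {X : Ω → ℝ} {B : ℝ}, 0 ≤ B → (∀ ω ∈ S, |X ω| ≤ B) → ∀ᵐ ω ∂μ, |X ω * χ ω| ≤ B := by
    intro X B hB hX
    refine ae_of_all _ fun ω => ?_
    by_cases h : ω ∈ S
    · have : χ ω = 1 := by simp [hχ, h]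
      rw [this, mul_one]
      exact hX ω h
    · have : χ ω = 0 := by simp [hχ, h]
      rw [this, mul_zero, abs_zero]
      exact hB
  have hWχ : Real.exp (-W) ≤ ∫ ω, χ ω ∂μ := by
    rw [hχ, integral_indicator_one hS]
    exact hW
  have h := abs_log_integral_perBox_le (t := t) (E₂₉ := E₂₉) (E₃₁ := E₃₁) (e₀ := e₀) hχm hχ0 hχ1 hYm hDm
    (fun c => cut hK0 (hYK c)) (cut hK0 h01K) (cut hK0 h02K) (cut hK0 hΨK) (cut hε0 hDε) hε0 hεK hWχ h29 h31
  rw [integral_mul_exp_mul_eq_of_indicator hχ01, integral_mul_exp_mul_eq_of_indicator hχ01] at h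
  have hset : ∀ X : Ω → ℝ, ∫ ω, χ ω * Real.exp (X ω) ∂μ = ∫ ω in S, Real.exp (X ω) ∂μ := by
    intro X
    rw [← integral_indicator hS]
    refine integral_congr_ae (ae_of_all _ fun ω => ?_)
    by_cases hω : ω ∈ S
    · simp [hχ, hω]
    · simp [hχ, hω]
  rw [hset, hset] at h
  exact h

/-- **THE PER-COLOURING ENTRY POINT** — the form in which the analytic suppliers deliver: if at each order `k ≤ t` every
colouring `f` using both `1` and `2` has `|𝓔^T((Y χ)_f)| ≤ δ₂₉(k)` ((5.29): «the replacement of the χ's by 1» —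
`B1Eq324BenfattoSect5ChiToOne` — then Appendix D's clustering between `Ψ″₁` (a leg in `□′∖Γ₄(□)`) and `Ψ₂` (legs near
`Γ₂(□)`) — `B1Eq324BenfattoAppendixDClustering`/`…Wick`), and every colouring using `1` and avoiding `2` has
`|𝓔^T((Yχ)_f) − u₀(k,f)| ≤ δ₃₁(k)` ((5.31): χ → 1, then conditioned → free, `B1Eq324BenfattoSect5CondToFree`; `u₀(k,f)` =
the free joint truncated expectation `Ê₀^T` of the uncut slots), then the per-box relation holds with
`e₀(k) = Σ_f u₀(k,f)`, `E₂₉(k) = 3^k δ₂₉(k)`, `E₃₁(k) = 3^k δ₃₁(k)`. [cite: BenfattoEtAl1978, (5.29)–(5.32) pp.157–158] -/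
theorem abs_log_integral_perBox_le_of_colourings {Y : Fin 3 → Ω → ℝ} {D χ : Ω → ℝ} {K ε W : ℝ} {t : ℕ}
    {δ₂₉ δ₃₁ : ℕ → ℝ} {u₀ : (n : ℕ) → (Fin n → Fin 3) → ℝ}
    (hχm : Measurable χ) (hχ0 : ∀ ω, 0 ≤ χ ω) (hχ1 : ∀ ω, χ ω ≤ 1)
    (hYm : ∀ c, AEStronglyMeasurable (Y c) μ) (hDm : AEStronglyMeasurable D μ)
    (hYK : ∀ c, ∀ᵐ ω ∂μ, |Y c ω * χ ω| ≤ K)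
    (h01K : ∀ᵐ ω ∂μ, |(Y 0 ω + Y 1 ω) * χ ω| ≤ K)
    (h02K : ∀ᵐ ω ∂μ, |(Y 0 ω + Y 2 ω) * χ ω| ≤ K)
    (hΨK : ∀ᵐ ω ∂μ, |(Y 0 ω + Y 1 ω + Y 2 ω + D ω) * χ ω| ≤ K)
    (hDε : ∀ᵐ ω ∂μ, |D ω * χ ω| ≤ ε) (hε0 : 0 ≤ ε) (hεK : ε ≤ K)
    (hW : Real.exp (-W) ≤ ∫ ω, χ ω ∂μ)
    (hδ₂₉ : ∀ k, 0 ≤ δ₂₉ k) (hδ₃₁ : ∀ k, 0 ≤ δ₃₁ k)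
    (h29 : ∀ k < t, ∀ f : Fin (k + 1) → Fin 3, (∃ j, f j = 1) → (∃ j, f j = 2) →
        |ursellOf (fun P : Finset (Fin (k + 1)) => ∫ ω, ∏ j ∈ P, Y (f j) ω * χ ω ∂μ) univ| ≤ δ₂₉ (k + 1))
    (h31 : ∀ k < t, ∀ f : Fin (k + 1) → Fin 3, (∃ j, f j = 1) → (∀ j, f j ≠ 2) →
        |ursellOf (fun P : Finset (Fin (k + 1)) => ∫ ω, ∏ j ∈ P, Y (f j) ω * χ ω ∂μ) univ - u₀ (k + 1) f|
          ≤ δ₃₁ (k + 1)) :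
    |Real.log (∫ ω, χ ω * Real.exp ((Y 0 ω + Y 1 ω + Y 2 ω + D ω) * χ ω) ∂μ)
        - Real.log (∫ ω, χ ω * Real.exp ((Y 0 ω + Y 2 ω) * χ ω) ∂μ)
        - ∑ k ∈ Finset.range t,
            (∑ f ∈ univ.filter (fun f : Fin (k + 1) → Fin 3 => (∃ j, f j = 1) ∧ ∀ j, f j ≠ 2), u₀ (k + 1) f)
              / (k + 1)!| ≤
      2 * (2 ^ ((t + 1).choose 2) * K ^ (t + 1) / (t + 1)!) + Real.exp (2 * K) * W
        + ∑ k ∈ Finset.range t,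
            (3 ^ (k + 1) * ((∑ π ∈ setPartitions (univ : Finset (Fin (k + 1))), ((π.card - 1)! : ℝ))
              * (ε * K ^ k)) + 3 ^ (k + 1) * δ₂₉ (k + 1) + 3 ^ (k + 1) * δ₃₁ (k + 1)) / (k + 1)! := by
  refine abs_log_integral_perBox_le (E₂₉ := fun k => 3 ^ k * δ₂₉ k) (E₃₁ := fun k => 3 ^ k * δ₃₁ k)
    (e₀ := fun k => match k with
      | 0 => 0
      | n + 1 => ∑ f ∈ univ.filter (fun f : Fin (n + 1) → Fin 3 => (∃ j, f j = 1) ∧ ∀ j, f j ≠ 2), u₀ (n + 1) f)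
    hχm hχ0 hχ1 hYm hDm hYK h01K h02K hΨK hDε hε0 hεK hW (fun k hk => ?_) (fun k hk => ?_)
  · have h := abs_sum_filter_le_three_pow (σ := Fin (k + 1))
      (g := fun f => ursellOf (fun P : Finset (Fin (k + 1)) => ∫ ω, ∏ j ∈ P, Y (f j) ω * χ ω ∂μ) univ)
      (fun f : Fin (k + 1) → Fin 3 => (∃ j, f j = 1) ∧ ∃ j, f j = 2) (hδ₂₉ (k + 1))
      (fun f hf => h29 k hk f hf.1 hf.2)
    rwa [Fintype.card_fin] at h
  · dsimp only
    rw [← Finset.sum_sub_distrib]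
    have h := abs_sum_filter_le_three_pow (σ := Fin (k + 1))
      (g := fun f => ursellOf (fun P : Finset (Fin (k + 1)) => ∫ ω, ∏ j ∈ P, Y (f j) ω * χ ω ∂μ) univ
        - u₀ (k + 1) f)
      (fun f : Fin (k + 1) → Fin 3 => (∃ j, f j = 1) ∧ ∀ j, f j ≠ 2) (hδ₃₁ (k + 1))
      (fun f hf => h31 k hk f hf.1 hf.2)
    rwa [Fintype.card_fin] at h

end TwoSided

/-! ## §5  Multiplicative forms (print's (5.30)/(5.32) are products of exponentials) -/

section ExpForm

variable {Ω : Type*} {mΩ : MeasurableSpace Ω} {μ : Measure Ω} [IsProbabilityMeasure μ]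

/-- Positivity of the cut exponential moment: `0 < ∫ χe^{X} dP̄` when `∫χ ≥ e^{−W}` and `|X| ≤ K` a.e. [folklore] -/
private theorem integral_mul_exp_pos {χ X : Ω → ℝ} {K W : ℝ}
    (hχm : Measurable χ) (hχ0 : ∀ ω, 0 ≤ χ ω) (hχ1 : ∀ ω, χ ω ≤ 1)
    (hXm : AEMeasurable X μ) (hXK : ∀ᵐ ω ∂μ, |X ω| ≤ K) (hW : Real.exp (-W) ≤ ∫ ω, χ ω ∂μ) :
    0 < ∫ ω, χ ω * Real.exp (X ω) ∂μ :=
  lt_of_lt_of_le (mul_pos (Real.exp_pos _) ((Real.exp_pos _).trans_le hW))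
    (exp_neg_mul_integral_le_integral_mul_exp hχm hχ0 hχ1 hXm hXK)

/-- **(5.30)/(5.32)–(5.33) PER BOX, MULTIPLICATIVE FORM** (the shape print writes: `∫P̄χ e^{Ψχ} ≧ exp(−error)·exp[Σ 1/(k₁!k₂!)Ê₀^T(Ψ″₁,Ψ′₁)]
·∫P̄χ exp(Ψ′₁+Ψ₂)`): under the hypotheses of `eq530_lower`,
`exp(Σ_{k≤t}e₀(k)/k! − error)·∫χe^{(Y₀+Y₂)χ}dP̄ ≤ ∫χe^{Ψχ}dP̄`. [cite: BenfattoEtAl1978, (5.30)–(5.33) pp.158–159] -/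
theorem eq530_lower_exp {Y : Fin 3 → Ω → ℝ} {D χ : Ω → ℝ} {K ε W : ℝ} {t : ℕ} {E₂₉ E₃₁ e₀ : ℕ → ℝ}
    (hχm : Measurable χ) (hχ0 : ∀ ω, 0 ≤ χ ω) (hχ1 : ∀ ω, χ ω ≤ 1)
    (hYm : ∀ c, AEStronglyMeasurable (Y c) μ) (hDm : AEStronglyMeasurable D μ)
    (hYK : ∀ c, ∀ᵐ ω ∂μ, |Y c ω * χ ω| ≤ K)
    (h01K : ∀ᵐ ω ∂μ, |(Y 0 ω + Y 1 ω) * χ ω| ≤ K)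
    (h02K : ∀ᵐ ω ∂μ, |(Y 0 ω + Y 2 ω) * χ ω| ≤ K)
    (hΨK : ∀ᵐ ω ∂μ, |(Y 0 ω + Y 1 ω + Y 2 ω + D ω) * χ ω| ≤ K)
    (hDε : ∀ᵐ ω ∂μ, |D ω * χ ω| ≤ ε) (hε0 : 0 ≤ ε) (hεK : ε ≤ K)
    (hW : Real.exp (-W) ≤ ∫ ω, χ ω ∂μ)
    (h29 : ∀ k < t, |∑ f ∈ univ.filter (fun f : Fin (k + 1) → Fin 3 => (∃ j, f j = 1) ∧ ∃ j, f j = 2),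
        ursellOf (fun P : Finset (Fin (k + 1)) => ∫ ω, ∏ j ∈ P, Y (f j) ω * χ ω ∂μ) univ| ≤ E₂₉ (k + 1))
    (h31 : ∀ k < t, |(∑ f ∈ univ.filter (fun f : Fin (k + 1) → Fin 3 => (∃ j, f j = 1) ∧ ∀ j, f j ≠ 2),
        ursellOf (fun P : Finset (Fin (k + 1)) => ∫ ω, ∏ j ∈ P, Y (f j) ω * χ ω ∂μ) univ) - e₀ (k + 1)|
        ≤ E₃₁ (k + 1)) :
    Real.exp ((∑ k ∈ Finset.range t, e₀ (k + 1) / (k + 1)!)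
        - (2 * (2 ^ ((t + 1).choose 2) * K ^ (t + 1) / (t + 1)!) + Real.exp (2 * K) * W
          + ∑ k ∈ Finset.range t,
              (3 ^ (k + 1) * ((∑ π ∈ setPartitions (univ : Finset (Fin (k + 1))), ((π.card - 1)! : ℝ))
                * (ε * K ^ k)) + E₂₉ (k + 1) + E₃₁ (k + 1)) / (k + 1)!))
      * ∫ ω, χ ω * Real.exp ((Y 0 ω + Y 2 ω) * χ ω) ∂μ ≤
      ∫ ω, χ ω * Real.exp ((Y 0 ω + Y 1 ω + Y 2 ω + D ω) * χ ω) ∂μ := by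
  have hχm' : AEStronglyMeasurable χ μ := hχm.aestronglyMeasurable
  have hΨm : AEMeasurable (fun ω => (Y 0 ω + Y 1 ω + Y 2 ω + D ω) * χ ω) μ :=
    (((((hYm 0).add (hYm 1)).add (hYm 2)).add hDm).mul hχm').aemeasurable
  have h02m : AEMeasurable (fun ω => (Y 0 ω + Y 2 ω) * χ ω) μ :=
    (((hYm 0).add (hYm 2)).mul hχm').aemeasurable
  have hA : 0 < ∫ ω, χ ω * Real.exp ((Y 0 ω + Y 2 ω) * χ ω) ∂μ :=
    integral_mul_exp_pos hχm hχ0 hχ1 h02m h02K hW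
  have hB : 0 < ∫ ω, χ ω * Real.exp ((Y 0 ω + Y 1 ω + Y 2 ω + D ω) * χ ω) ∂μ :=
    integral_mul_exp_pos hχm hχ0 hχ1 hΨm hΨK hW
  have h := eq530_lower hχm hχ0 hχ1 hYm hDm hYK h01K h02K hΨK hDε hε0 hεK hW h29 h31
  rw [← Real.log_le_log_iff (mul_pos (Real.exp_pos _) hA) hB, Real.log_mul (Real.exp_pos _).ne' hA.ne',
    Real.log_exp]
  linarith

/-- **(5.36) PER BOX, MULTIPLICATIVE FORM**: under the same hypotheses,
`∫χe^{Ψχ}dP̄ ≤ exp(Σ_{k≤t}e₀(k)/k! + error)·∫χe^{(Y₀+Y₂)χ}dP̄`. [cite: BenfattoEtAl1978, (5.36) p.159] -/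
theorem eq536_upper_exp {Y : Fin 3 → Ω → ℝ} {D χ : Ω → ℝ} {K ε W : ℝ} {t : ℕ} {E₂₉ E₃₁ e₀ : ℕ → ℝ}
    (hχm : Measurable χ) (hχ0 : ∀ ω, 0 ≤ χ ω) (hχ1 : ∀ ω, χ ω ≤ 1)
    (hYm : ∀ c, AEStronglyMeasurable (Y c) μ) (hDm : AEStronglyMeasurable D μ)
    (hYK : ∀ c, ∀ᵐ ω ∂μ, |Y c ω * χ ω| ≤ K)
    (h01K : ∀ᵐ ω ∂μ, |(Y 0 ω + Y 1 ω) * χ ω| ≤ K)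
    (h02K : ∀ᵐ ω ∂μ, |(Y 0 ω + Y 2 ω) * χ ω| ≤ K)
    (hΨK : ∀ᵐ ω ∂μ, |(Y 0 ω + Y 1 ω + Y 2 ω + D ω) * χ ω| ≤ K)
    (hDε : ∀ᵐ ω ∂μ, |D ω * χ ω| ≤ ε) (hε0 : 0 ≤ ε) (hεK : ε ≤ K)
    (hW : Real.exp (-W) ≤ ∫ ω, χ ω ∂μ)
    (h29 : ∀ k < t, |∑ f ∈ univ.filter (fun f : Fin (k + 1) → Fin 3 => (∃ j, f j = 1) ∧ ∃ j, f j = 2),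
        ursellOf (fun P : Finset (Fin (k + 1)) => ∫ ω, ∏ j ∈ P, Y (f j) ω * χ ω ∂μ) univ| ≤ E₂₉ (k + 1))
    (h31 : ∀ k < t, |(∑ f ∈ univ.filter (fun f : Fin (k + 1) → Fin 3 => (∃ j, f j = 1) ∧ ∀ j, f j ≠ 2),
        ursellOf (fun P : Finset (Fin (k + 1)) => ∫ ω, ∏ j ∈ P, Y (f j) ω * χ ω ∂μ) univ) - e₀ (k + 1)|
        ≤ E₃₁ (k + 1)) :
    ∫ ω, χ ω * Real.exp ((Y 0 ω + Y 1 ω + Y 2 ω + D ω) * χ ω) ∂μ ≤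
      Real.exp ((∑ k ∈ Finset.range t, e₀ (k + 1) / (k + 1)!)
        + (2 * (2 ^ ((t + 1).choose 2) * K ^ (t + 1) / (t + 1)!) + Real.exp (2 * K) * W
          + ∑ k ∈ Finset.range t,
              (3 ^ (k + 1) * ((∑ π ∈ setPartitions (univ : Finset (Fin (k + 1))), ((π.card - 1)! : ℝ))
                * (ε * K ^ k)) + E₂₉ (k + 1) + E₃₁ (k + 1)) / (k + 1)!))
      * ∫ ω, χ ω * Real.exp ((Y 0 ω + Y 2 ω) * χ ω) ∂μ := by
  have hχm' : AEStronglyMeasurable χ μ := hχm.aestronglyMeasurable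
  have hΨm : AEMeasurable (fun ω => (Y 0 ω + Y 1 ω + Y 2 ω + D ω) * χ ω) μ :=
    (((((hYm 0).add (hYm 1)).add (hYm 2)).add hDm).mul hχm').aemeasurable
  have h02m : AEMeasurable (fun ω => (Y 0 ω + Y 2 ω) * χ ω) μ :=
    (((hYm 0).add (hYm 2)).mul hχm').aemeasurable
  have hA : 0 < ∫ ω, χ ω * Real.exp ((Y 0 ω + Y 2 ω) * χ ω) ∂μ :=
    integral_mul_exp_pos hχm hχ0 hχ1 h02m h02K hW
  have hB : 0 < ∫ ω, χ ω * Real.exp ((Y 0 ω + Y 1 ω + Y 2 ω + D ω) * χ ω) ∂μ :=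
    integral_mul_exp_pos hχm hχ0 hχ1 hΨm hΨK hW
  have h := eq536_upper hχm hχ0 hχ1 hYm hDm hYK h01K h02K hΨK hDε hε0 hεK hW h29 h31
  rw [← Real.log_le_log_iff hB (mul_pos (Real.exp_pos _) hA), Real.log_mul (Real.exp_pos _).ne' hA.ne',
    Real.log_exp]
  linarith

end ExpForm

end Literature.MathematicalPhysics.QuantumFieldTheory.Balaban1983to89.B1Eq324BenfattoSect5PerBox
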